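import Literature.NumberTheory.Automorphic.ClozelCArithmeticProofs
import Literature.NumberTheory.Automorphic.ClozelAlgebraicityCMAssemblyProofs
import Literature.NumberTheory.Automorphic.GLOneArchParameterOfAlgebraicCharacter
import Literature.NumberTheory.GaloisRepresentations.AlgebraicHeckeCharacterPurity
import HarnessLib

/-!
# Clozel's algebraicity theorem (Thm. 3.13) in rank one: the `n = 1` slice of
# `Clozel1990_regularAlgebraic` (all four clauses), proved

Topic `Literature/NumberTheory/Automorphic`; namespace `Literature.NumberTheory.Automorphic`.
PROOFS file (theorems only: no definition, no named fact, no instance), sequel to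
`ClozelCArithmeticProofs` (there: the Hecke field, clause (i) and the finite part of clause (ii)
for `n = 1`). Here the archimedean half of clause (ii), the purity clause (iii) and — through the
tree's assembly of Patrikis's argument, `ClozelAlgebraicityCMAssemblyProofs` — the CM clause (iv)
of the named fact `Clozel1990_regularAlgebraic` (`ClozelAlgebraicity.lean`; Clozel 1990, Thm. 3.13
and Lemme 4.9; Patrikis 2019, Cor. 3.2.3) for `n = 1`, on an ARBITRARY cuspidal regular algebraic
datum `π` on `GL₁(𝔸_K)`, `K` any number field — by Clozel's §1 dictionary these are statements
about the algebraic Hecke character `χ_π` of `π` (Weil 1956):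

* `AutomorphicRepData.heckeCharacter_of_eq_span_detTwist_glOne` — the Borel–Jacquet line
  `π_θ = ℂ·(θ∘det)/⊥` has Hecke character `θ` (`r(g) φ = θ(det g) φ`).
* `CuspidalAutomorphicRepData.exists_cuspidal_isAutConjugate_infinityType_rank_one` — **clause
  (ii) for `n = 1` in full**: for every `σ ∈ Aut(ℂ)` the cuspidal conjugate `π' = π_{^σχ_π}`
  (`exists_cuspidal_isAutConjugate_rank_one`) is a `σ`-conjugate at almost all places AND, for
  every infinity type `T` of `π`, has an infinity type with the `a`-multisets of `^σT`: the
  `a`-multiset of any infinity type of `π` at `ι` is `{-n_ι}` (`n` the exponents of `χ_π`,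
  `map_a_eq_of_hasInfinityType_heckeCharacter_glOne`), that of `π'` is `{-n^σ_ι}` with
  `n^σ_ι = n_{σ⁻¹ι}` (`hasInfinityType_autConj`, `embExponent_autConjType`), and
  `(^σT)(ι) = T(σ⁻¹ι)`.
* `CuspidalAutomorphicRepData.purity_rank_one` — **clause (iii) for `n = 1`**: there is `w ∈ ℤ`
  with `{a at c∘ι} = {w − a : a at ι}` for every infinity type of `π` (Weil's weight of a type-`A₀`
  character: `n_ι + n_ῑ = wt`, `HasInfinityType.exists_embExponent_add_conjugate_eq`; `w = -wt`).
* `CuspidalAutomorphicRepData.clozel1990_regularAlgebraic_rank_one_i_ii_iii` — the conjunction of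
  clauses (i)–(iii) of `Clozel1990_regularAlgebraic` at `n = 1`, verbatim.
* `CuspidalAutomorphicRepData.isTotallyReal_or_isCMField_ratField_rank_one` — clause (iv) for
  `n = 1` (`isTotallyReal_or_isCMField_ratField_of_clauses`, Patrikis Cor. 3.2.3 assembled in the
  tree from (i)–(iii)); and **`Clozel1990_regularAlgebraic.rank_one`** — the `n = 1` slice of the
  named fact VERBATIM, all four clauses.

Not here: any `n ≥ 2`.

## References

* L. Clozel, *Motifs et formes automorphes: applications du principe de fonctorialité*, in
  Automorphic forms, Shimura varieties, and L-functions I (1990), §1, Thm. 3.13, Lemme 4.9.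
  [Clozel1990]
* A. Weil, *On a certain type of characters of the idèle-class group of an algebraic
  number-field*, Proc. Int. Symp. Tokyo–Nikko 1955 (1956), 1–7, §1. [Weil1956]
-/

open scoped Classical NumberField
open NumberField IsDedekindDomain Filter

namespace Literature.NumberTheory.Automorphic

open Literature.NumberTheory.GaloisRepresentations

variable {K : Type} [Field K] [NumberField K] {hcpt : isCompact_glFiniteIntegralLevel 1 K}

/-- **The line `π_θ = ℂ·(θ∘det)/⊥` has Hecke character `θ`**: `r(g) φ - θ(det g) φ ∈ W' = ⊥` for
every `φ ∈ W = ℂ·(θ∘det)` (`rightTranslation_detTwist_glOne`). Borel–Jacquet 1979, 4.6; Gelbart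
1975, §2.A. [cite: BorelJacquet1979, 4.6] -/
theorem AutomorphicRepData.heckeCharacter_of_eq_span_detTwist_glOne {θ : HeckeCharacter K}
    {π : AutomorphicRepData (AutomorphyDatum.gl 1 K hcpt)}
    (hW : π.W = Submodule.span ℂ {fun g : (AdelicGroupData.gl 1 K).Adelic ↦ (detTwist 1 θ g : ℂ)})
    (hW' : π.W' = ⊥) :
    ∀ (g : (AdelicGroupData.gl 1 K).Adelic), ∀ φ ∈ π.W,
      rightTranslation (AdelicGroupData.gl 1 K) g φ -
        ((θ (Matrix.GeneralLinearGroup.det g) : ℂˣ) : ℂ) • φ ∈ π.W' := by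
  intro g φ hφ
  rw [hW, Submodule.mem_span_singleton] at hφ
  obtain ⟨c, rfl⟩ := hφ
  rw [hW', Submodule.mem_bot, sub_eq_zero, map_smul, rightTranslation_detTwist_glOne, smul_comm,
    detTwist_apply']

/-- **Clause (ii) of Clozel's Thm. 3.13 for `GL₁`, in full, proved.** For `π` cuspidal regular
algebraic on `GL₁(𝔸_K)` and `σ ∈ Aut(ℂ)` there is a cuspidal `π'` on `GL₁(𝔸_K)` which is a
`σ`-conjugate of `π` at almost all places and whose infinity types have the `a`-multisets of
`^σT` for every infinity type `T` of `π`: `π' = π_{^σχ_π}` for the algebraic Hecke character `χ_π`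
of `π` (finite part: `isAutConjugate_glOne_autConj_of_heckeCharacter`; archimedean part: the
`a`-multiset of `T` at `ι` is `{-n_ι}`, that of `π'` is `{-n_{σ⁻¹ι}} = (^σT)(ι)`).
Clozel 1990, Thm. 3.13 (ii) for `n = 1`; Weil 1956, §1. [cite: Clozel1990, Thm. 3.13 (ii) (n = 1)] -/
theorem CuspidalAutomorphicRepData.exists_cuspidal_isAutConjugate_infinityType_rank_one
    (π : CuspidalAutomorphicRepData 1 K hcpt) (hπ : π.1.IsRegularAlgebraic) (σ : ℂ ≃ₐ[ℚ] ℂ) :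
    ∃ π' : CuspidalAutomorphicRepData 1 K hcpt, IsAutConjugate σ π.1 π'.1 ∧
      ∀ T : InfinityType K 1, π.1.HasInfinityType T → T.IsRegularAlgebraic →
        ∃ T' : InfinityType K 1, π'.1.HasInfinityType T' ∧
          ∀ ι : K →+* ℂ, (T' ι).map ArchWeight.a = (T.autConj σ ι).map ArchWeight.a := by
  obtain ⟨χ, hχ⟩ := π.1.exists_heckeCharacter_glOne
  have halg : χ.IsAlgebraic :=
    π.1.isAlgebraic_heckeCharacter_glOne_of_isCAlgebraic hχ hπ.isCAlgebraic
  obtain ⟨p, q, h⟩ := (HeckeCharacter.isAlgebraic_iff_exists_hasInfinityType χ).mp halg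
  obtain ⟨π', hW₂, hW₂'⟩ := exists_automorphicRepData_detTwist_glOne hcpt (h.autConj σ)
  have hχ' := AutomorphicRepData.heckeCharacter_of_eq_span_detTwist_glOne hW₂ hW₂'
  refine ⟨⟨π', π'.W_le_cuspFormsGL_one⟩,
    π.1.isAutConjugate_glOne_autConj_of_heckeCharacter hχ h σ hW₂ hW₂', fun T hT _ ↦ ?_⟩
  obtain ⟨T', hT', hT'a⟩ :=
    π'.exists_hasInfinityType_of_hasInfinityType_heckeCharacter_glOne hχ' (h.hasInfinityType_autConj σ)
  refine ⟨T', hT', fun ι ↦ ?_⟩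
  rw [hT'a ι, HeckeCharacter.embExponent_autConjType, InfinityType.autConj_apply,
    π.1.map_a_eq_of_hasInfinityType_heckeCharacter_glOne hχ h hT]

/-- **Clause (iii) of Clozel's Thm. 3.13 (archimedean purity, Lemme 4.9) for `GL₁`, proved.** For
`π` cuspidal regular algebraic on `GL₁(𝔸_K)` there is `w ∈ ℤ` such that for every infinity type
`T` of `π` and every embedding `ι`, the `a`-multiset of `T` at `c ∘ ι` is `{w − a : a ∈ T(ι)}`:
the `a`-multiset at `ι` is `{-n_ι}` for the exponents `n` of the algebraic Hecke character of `π`,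
and `n_ι + n_ῑ = wt` is Weil's weight (`HasInfinityType.exists_embExponent_add_conjugate_eq`);
`w = -wt`. Clozel 1990, Lemme 4.9 for `n = 1`; Weil 1956, §1.
[cite: Clozel1990, Lemme 4.9 (n = 1)] [cite: Weil1956, §1] -/
theorem CuspidalAutomorphicRepData.purity_rank_one (π : CuspidalAutomorphicRepData 1 K hcpt)
    (hπ : π.1.IsRegularAlgebraic) :
    ∃ w : ℤ, ∀ T : InfinityType K 1, π.1.HasInfinityType T →
      ∀ ι : K →+* ℂ, (T ((starRingEnd ℂ).comp ι)).map ArchWeight.a =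
        ((T ι).map ArchWeight.a).map fun a ↦ (w : ℂ) - a := by
  obtain ⟨χ, hχ⟩ := π.1.exists_heckeCharacter_glOne
  have halg : χ.IsAlgebraic :=
    π.1.isAlgebraic_heckeCharacter_glOne_of_isCAlgebraic hχ hπ.isCAlgebraic
  obtain ⟨p, q, h⟩ := (HeckeCharacter.isAlgebraic_iff_exists_hasInfinityType χ).mp halg
  obtain ⟨wt, hwt⟩ := h.exists_embExponent_add_conjugate_eq
  refine ⟨-wt, fun T hT ι ↦ ?_⟩
  have hconj : (starRingEnd ℂ).comp ι = ComplexEmbedding.conjugate ι := rfl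
  rw [π.1.map_a_eq_of_hasInfinityType_heckeCharacter_glOne hχ h hT ι, hconj,
    π.1.map_a_eq_of_hasInfinityType_heckeCharacter_glOne hχ h hT (ComplexEmbedding.conjugate ι),
    Multiset.map_singleton]
  have hC : (HeckeCharacter.embExponent p q ι : ℂ) +
      (HeckeCharacter.embExponent p q (ComplexEmbedding.conjugate ι) : ℂ) = (wt : ℂ) := by
    exact_mod_cast hwt ι
  congr 1
  push_cast
  linear_combination -hC

/-- **Clauses (i), (ii), (iii) of `Clozel1990_regularAlgebraic` for `n = 1`, verbatim, proved**
(`finiteDimensional_ratField_rank_one`, `exists_cuspidal_isAutConjugate_infinityType_rank_one`,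
`purity_rank_one`; clause (iv), the CM property of `ℚ(π_f)`, is not proved in the tree).
Clozel 1990, Thm. 3.13 and Lemme 4.9 for `n = 1` = Weil 1956. [cite: Clozel1990, Thm. 3.13 (n = 1)] -/
theorem CuspidalAutomorphicRepData.clozel1990_regularAlgebraic_rank_one_i_ii_iii
    (hcpt : isCompact_glFiniteIntegralLevel 1 K) (π : CuspidalAutomorphicRepData 1 K hcpt)
    (hπ : π.1.IsRegularAlgebraic) :
    FiniteDimensional ℚ (ratField π.1) ∧
    (∀ σ : ℂ ≃ₐ[ℚ] ℂ, ∃ π' : CuspidalAutomorphicRepData 1 K hcpt,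
      IsAutConjugate σ π.1 π'.1 ∧
      ∀ T : InfinityType K 1, π.1.HasInfinityType T → T.IsRegularAlgebraic →
        ∃ T' : InfinityType K 1, π'.1.HasInfinityType T' ∧
          ∀ ι : K →+* ℂ, (T' ι).map ArchWeight.a = (T.autConj σ ι).map ArchWeight.a) ∧
    (∀ T : InfinityType K 1, π.1.HasInfinityType T → T.IsRegularAlgebraic →
      ∃ w : ℤ, ∀ ι : K →+* ℂ, (T ((starRingEnd ℂ).comp ι)).map ArchWeight.a =
        ((T ι).map ArchWeight.a).map fun a ↦ (w : ℂ) - a) := by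
  refine ⟨π.finiteDimensional_ratField_rank_one hπ,
    fun σ ↦ π.exists_cuspidal_isAutConjugate_infinityType_rank_one hπ σ, fun T hT _ ↦ ?_⟩
  obtain ⟨w, hw⟩ := π.purity_rank_one hπ
  exact ⟨w, hw T hT⟩

/-- **Clause (iv) of Clozel's Thm. 3.13 for `GL₁`, proved: `ℚ(π_f)` is totally real or CM**
(Patrikis 2019, Cor. 3.2.3 for `n = 1`), from clauses (i)–(iii) in rank one by the tree's
assembly of Patrikis's argument (`isTotallyReal_or_isCMField_ratField_of_clauses` of
`ClozelAlgebraicityCMAssemblyProofs`: clean unitary model, Petersson pairing, `^{cσ}π ~ ^{σc}π`).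
[cite: Patrikis2019, Cor. 3.2.3 (n = 1)] [cite: Clozel1990, Thm. 3.13 (n = 1)] -/
theorem CuspidalAutomorphicRepData.isTotallyReal_or_isCMField_ratField_rank_one
    (π : CuspidalAutomorphicRepData 1 K hcpt) (hπ : π.1.IsRegularAlgebraic) :
    IsTotallyReal (ratField π.1) ∨ IsCMField (ratField π.1) := by
  obtain ⟨hi, hii, hiii⟩ := π.clozel1990_regularAlgebraic_rank_one_i_ii_iii hcpt hπ
  exact π.isTotallyReal_or_isCMField_ratField_of_clauses hπ hi hii hiii

/-- **`Clozel1990_regularAlgebraic` for `n = 1`, proved** — its `n = 1` slice VERBATIM (all four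
clauses: `ℚ(π_f)` is a number field; cuspidal `Aut(ℂ)`-conjugates with the conjugated infinity
type exist; archimedean purity; `ℚ(π_f)` totally real or CM), for every number field `K` and every
cuspidal regular algebraic `π` on `GL₁(𝔸_K)`. Clozel 1990, Thm. 3.13 with Lemme 4.9, and Patrikis
2019, Cor. 3.2.3, in rank one = Weil 1956 on algebraic Hecke characters, assembled from the tree's
`GL₁` dictionary. [cite: Clozel1990, Thm. 3.13 and Lemme 4.9 (n = 1)] [cite: Weil1956, §1] -/
theorem Clozel1990_regularAlgebraic.rank_one (K : Type) [Field K] [NumberField K]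
    (hcpt : isCompact_glFiniteIntegralLevel 1 K) (π : CuspidalAutomorphicRepData 1 K hcpt)
    (hπ : π.1.IsRegularAlgebraic) :
    FiniteDimensional ℚ (ratField π.1) ∧
    (∀ σ : ℂ ≃ₐ[ℚ] ℂ, ∃ π' : CuspidalAutomorphicRepData 1 K hcpt,
      IsAutConjugate σ π.1 π'.1 ∧
      ∀ T : InfinityType K 1, π.1.HasInfinityType T → T.IsRegularAlgebraic →
        ∃ T' : InfinityType K 1, π'.1.HasInfinityType T' ∧
          ∀ ι : K →+* ℂ, (T' ι).map ArchWeight.a = (T.autConj σ ι).map ArchWeight.a) ∧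
    (∀ T : InfinityType K 1, π.1.HasInfinityType T → T.IsRegularAlgebraic →
      ∃ w : ℤ, ∀ ι : K →+* ℂ, (T ((starRingEnd ℂ).comp ι)).map ArchWeight.a =
        ((T ι).map ArchWeight.a).map fun a => (w : ℂ) - a) ∧
    (IsTotallyReal (ratField π.1) ∨ IsCMField (ratField π.1)) := by
  obtain ⟨hi, hii, hiii⟩ := π.clozel1990_regularAlgebraic_rank_one_i_ii_iii hcpt hπ
  exact ⟨hi, hii, hiii, π.isTotallyReal_or_isCMField_ratField_of_clauses hπ hi hii hiii⟩

end Literature.NumberTheory.Automorphic
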